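import Mathlib
import HarnessLib
import Literature.MathematicalPhysics.QuantumFieldTheory.ConstructiveQFTWave0
import Summits.Ventures.LatticeQCDFlow.Scaling.PlaquetteIndependence2D
import Summits.Ventures.LatticeQCDFlow.Scaling.HaarConvolutionRatio

/-!
# LatticeQCDFlow / Scaling — two dimensions, abelian gauge group: plaquette marginals of the Wilson measure as Haar-convolution powers

HONEST FRAMING: exact (Metropolis-corrected) sampling algorithms for lattice gauge theory; figures of merit are
autocorrelation/cost numbers at stated couplings and volumes; no continuum-physics claim.

Venture `LatticeQCDFlow` (cell pub-lqcd), topic `Scaling`, FANOUT row 30 (lean-1) — OUR WORK, file 3 of the EXPLICIT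
`U(1)` tunnelling law in `d = 2`.  `Scaling/PlaquetteIndependence2D.lean`: under product Haar on the links of
`(ℤ/L)²` the plaquette holonomies off a puncture `x₀` are i.i.d. Haar.  For an ABELIAN group the holonomy AT the
puncture is determined by the others, `U_{x₀} = (∏_{x ≠ x₀} U_x)⁻¹` (every link enters two plaquettes with opposite
orientations), so the full Wilson weight `∏_x w(U_x)` is a function of the free holonomies and every plaquette
observable integrates over an honest product space.  Integrating out the plaquettes `R` away from a patch `P ∌ x₀`
produces the Haar-convolution power `K_w^{#R} w` of `Scaling/HaarConvolutionRatio.lean`: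

* `pi_map_restrict`, `lintegral_comp_plaquettes_eq_pi` — (any compact `G`) for `H` not depending on the `x₀`
  coordinate, `∫ H(U_·) dHaar^{⊗E}(U) = ∫ H dHaar^{⊗Λ}`;
* `prod_plaquetteHolonomy_eq_one` — (commutative `G`) `∏_x U_x = 1` on the 2-torus;
* `lmarginal_weight_prod_eq_iterate` — (commutative `G`) `∫⋯∫_R φ(a·∏_{r∈R} g_r)·∏_{r∈R} w(g_r) = (K_w^{#R} φ)(a)`;
* **`lintegral_weight_mul_eq_iterate`** — for `f` depending only on the plaquettes of `P ∌ x₀`,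
  `∫ f(U_·) e^{−βS(U)} dHaar^{⊗E} = ∫ f(g)·∏_{x∈P} w(g_x)·(K_w^{L²−1−#P} w)(∏_{x∈P} g_x) dHaar^{⊗Λ}(g)`;
  **`partitionFunction_two_eq_iterate`** — `Z_Λ(β) = (K_w^{L²−1} w)(1)`;
  **`lintegral_weight_mul_le`** — hence `∫ f(U_·) e^{−βS} ≤ (sup K_w^{L²−1−#P} w)·∫ f·∏_{x∈P} w(g_x) dHaar^{⊗Λ}`.

With the ratio bounds of `HaarConvolutionRatio` (`sup K_w^{2i+1+k} w ≤ (∫w)^k·a_{2i}`, `a_{2i}·a_2ⁿ ≤ a_0ⁿ·a_{2(i+n)}`)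
these turn every `P`-plaquette probability of the 2-d Wilson measure into an explicit multiple of the product
one-plaquette law (file 4, `Scaling/FluxTunnellingU1Explicit.lean`).  Elementary; nothing is cited; no `def`.
-/

noncomputable section

namespace Summit.Ventures.LatticeQCDFlow.Theory2.Lattice.TwoDim

open MeasureTheory Literature.MathematicalPhysics.QuantumFieldTheory
open Summit.Ventures.LatticeQCDFlow.Theory2.HaarConv
open scoped ENNReal

variable {L : ℕ} {G : Type*} [Group G] [TopologicalSpace G] [IsTopologicalGroup G] [CompactSpace G]
  [SecondCountableTopology G] [MeasurableSpace G] [BorelSpace G]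

/-! ## §1. From links to an honest product of plaquettes (any compact `G`) -/

omit [Group G] [TopologicalSpace G] [IsTopologicalGroup G] [CompactSpace G] [SecondCountableTopology G]
  [BorelSpace G] in
/-- Restricting a product probability measure to the coordinates `≠ x₀` gives the product measure.
[folklore] -/
theorem pi_map_restrict {ι : Type*} [Fintype ι] [DecidableEq ι] (μ : Measure G)
    [IsProbabilityMeasure μ] (x₀ : ι) :
    (Measure.pi fun _ : ι => μ).map (fun (g : ι → G) (x : {x : ι // x ≠ x₀}) => g x.1) =
      Measure.pi fun _ : {x : ι // x ≠ x₀} => μ := by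
  have he := measurePreserving_piEquivPiSubtypeProd (fun _ : ι => μ) (fun x => x ≠ x₀)
  have hfac : (fun (g : ι → G) (x : {x : ι // x ≠ x₀}) => g x.1) =
      Prod.fst ∘ (MeasurableEquiv.piEquivPiSubtypeProd (fun _ : ι => G) (fun x => x ≠ x₀)) := by
    funext g; rfl
  rw [hfac, ← Measure.map_map measurable_fst (MeasurableEquiv.measurable _), he.map_eq,
    Measure.map_fst_prod, measure_univ, one_smul]

/-- **From links to plaquettes.**  On `(ℤ/L)²`, `L ≥ 2`: for every measurable `H` on plaquette fields
`Λ → G` that does not depend on the coordinate `x₀`,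
`∫ H(U_·) dHaar^{⊗E}(U) = ∫ H dHaar^{⊗Λ}` (`Scaling/PlaquetteIndependence2D.lean`). [folklore] -/
theorem lintegral_comp_plaquettes_eq_pi [NeZero L] (hL : 2 ≤ L) (x₀ : Site 2 L)
    {H : (Site 2 L → G) → ℝ≥0∞} (hHm : Measurable H)
    (hH : ∀ g v, H (Function.update g x₀ v) = H g) :
    ∫⁻ U, H (fun x => plaquetteHolonomy U x 0 1) ∂(Measure.pi fun _ : Edge 2 L => haarProbability G) =
      ∫⁻ g, H g ∂(Measure.pi fun _ : Site 2 L => haarProbability G) := by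
  classical
  -- extension by `1` at `x₀` and restriction to `x ≠ x₀`
  let e : ({x : Site 2 L // x ≠ x₀} → G) → (Site 2 L → G) :=
    fun g' x => if h : x = x₀ then 1 else g' ⟨x, h⟩
  let r : (Site 2 L → G) → ({x : Site 2 L // x ≠ x₀} → G) := fun g x => g x.1
  have he : Measurable e := by
    refine measurable_pi_lambda _ fun x => ?_
    by_cases h : x = x₀
    · simp only [e, h, dif_pos]; exact measurable_const
    · simp only [e, h, dif_neg, not_false_eq_true]; exact measurable_pi_apply _
  have hr : Measurable r := measurable_pi_lambda _ fun x => measurable_pi_apply _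
  have her : ∀ g, e (r g) = Function.update g x₀ 1 := by
    intro g; funext x
    by_cases h : x = x₀
    · subst h; simp [e]
    · simp [e, r, h]
  have hHer : ∀ g, H g = (H ∘ e) (r g) := fun g => by
    simp only [Function.comp_apply, her, hH]
  have hΦ : Measurable fun (U : GaugeConfig 2 L G) (x : {x : Site 2 L // x ≠ x₀}) =>
      plaquetteHolonomy U x.1 0 1 :=
    measurable_pi_lambda _ fun x => measurable_plaquetteHolonomy x.1
  calc ∫⁻ U, H (fun x => plaquetteHolonomy U x 0 1) ∂(Measure.pi fun _ : Edge 2 L => haarProbability G)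
      = ∫⁻ U, (H ∘ e) (fun x : {x : Site 2 L // x ≠ x₀} => plaquetteHolonomy U x.1 0 1)
          ∂(Measure.pi fun _ : Edge 2 L => haarProbability G) :=
        lintegral_congr fun U => hHer _
    _ = ∫⁻ g', (H ∘ e) g' ∂((Measure.pi fun _ : Edge 2 L => haarProbability G).map
          (fun (U : GaugeConfig 2 L G) (x : {x : Site 2 L // x ≠ x₀}) => plaquetteHolonomy U x.1 0 1)) :=
        (lintegral_map (hHm.comp he) hΦ).symm
    _ = ∫⁻ g', (H ∘ e) g' ∂(Measure.pi fun _ : {x : Site 2 L // x ≠ x₀} => haarProbability G) := by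
        rw [map_plaquettes_eq_pi hL x₀]
    _ = ∫⁻ g', (H ∘ e) g' ∂((Measure.pi fun _ : Site 2 L => haarProbability G).map r) := by
        rw [pi_map_restrict]
    _ = ∫⁻ g, (H ∘ e) (r g) ∂(Measure.pi fun _ : Site 2 L => haarProbability G) :=
        lintegral_map (hHm.comp he) hr
    _ = ∫⁻ g, H g ∂(Measure.pi fun _ : Site 2 L => haarProbability G) :=
        lintegral_congr fun g => (hHer g).symm

/-! ## §2. Abelian gauge group: the total flux vanishes -/

section Abelian

variable {G : Type*} [CommGroup G]

/-- **`∏_x U_x = 1` on the 2-torus** for an abelian group: every link is traversed once forwards and once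
backwards. [folklore] -/
theorem prod_plaquetteHolonomy_eq_one [NeZero L] (U : GaugeConfig 2 L G) :
    ∏ x : Site 2 L, plaquetteHolonomy U x 0 1 = 1 := by
  simp only [plaquetteHolonomy, Finset.prod_mul_distrib, Finset.prod_inv_distrib]
  have h0 : ∏ x : Site 2 L, U (x.shift 0, 1) = ∏ x : Site 2 L, U (x, 1) :=
    Fintype.prod_equiv (Equiv.addRight (Pi.single 0 1)) _ _ fun x => rfl
  have h1 : ∏ x : Site 2 L, U (x.shift 1, 0) = ∏ x : Site 2 L, U (x, 0) :=
    Fintype.prod_equiv (Equiv.addRight (Pi.single 1 1)) _ _ fun x => rfl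
  rw [h0, h1, mul_inv_cancel_comm, mul_inv_cancel]

/-- Hence the holonomy at the puncture is the inverse product of the others. [folklore] -/
theorem plaquetteHolonomy_eq_inv_prod_erase [NeZero L] (U : GaugeConfig 2 L G) (x₀ : Site 2 L) :
    plaquetteHolonomy U x₀ 0 1 = (∏ x ∈ Finset.univ.erase x₀, plaquetteHolonomy U x 0 1)⁻¹ := by
  have h := prod_plaquetteHolonomy_eq_one U
  rw [← Finset.mul_prod_erase _ _ (Finset.mem_univ x₀)] at h
  exact eq_inv_of_mul_eq_one_left h

end Abelian

/-! ## §3. Integrating out plaquettes: Haar-convolution powers -/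

section Marginal

variable {G : Type*} [CommGroup G] [TopologicalSpace G] [IsTopologicalGroup G] [CompactSpace G]
  [SecondCountableTopology G] [MeasurableSpace G] [BorelSpace G]

omit [CommGroup G] [TopologicalSpace G] [IsTopologicalGroup G] [CompactSpace G] [SecondCountableTopology G]
  [BorelSpace G] in
/-- A factor that does not depend on the integrated coordinates comes out of `lmarginal`. [folklore] -/
theorem lmarginal_mul_indep {ι : Type*} [DecidableEq ι] (μ : Measure G) [SigmaFinite μ] (R : Finset ι)
    {F c : (ι → G) → ℝ≥0∞} (hF : Measurable F)
    (hc : ∀ x (y : (i : ↥R) → G), c (Function.updateFinset x R y) = c x) :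
    (∫⋯∫⁻_R, (fun z => F z * c z) ∂fun _ : ι => μ) = fun x => (∫⋯∫⁻_R, F ∂fun _ : ι => μ) x * c x := by
  funext x
  simp only [lmarginal, hc]
  exact lintegral_mul_const (c x) (hF.comp measurable_updateFinset)

/-- **Integrating out the plaquettes of `R`**: for `a` measurable and independent of the `R`-coordinates,
`∫⋯∫_R φ(a·∏_{r∈R} g_r)·∏_{r∈R} w(g_r) dHaar^R = (K_w^{#R} φ)(a)` (commutative `G`). [folklore] -/
theorem lmarginal_weight_prod_eq_iterate {w φ : G → ℝ≥0∞} (hw : Measurable w) (hφ : Measurable φ)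
    (R : Finset (Site 2 L)) {a : (Site 2 L → G) → G} (ham : Measurable a)
    (ha : ∀ g, ∀ r ∈ R, ∀ v, a (Function.update g r v) = a g) :
    (∫⋯∫⁻_R, (fun g => φ (a g * ∏ r ∈ R, g r) * ∏ r ∈ R, w (g r))
        ∂fun _ : Site 2 L => haarProbability G) =
      fun g => (haarConv w)^[R.card] φ (a g) := by
  classical
  induction R using Finset.induction_on generalizing a with
  | empty => funext g; simp
  | @insert r R hr ih =>
    funext g
    have hmeas : Measurable fun g : Site 2 L → G =>
        φ (a g * ∏ r ∈ insert r R, g r) * ∏ r ∈ insert r R, w (g r) :=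
      (hφ.comp (ham.mul (Finset.measurable_prod _ fun i _ => measurable_pi_apply i))).mul
        (Finset.measurable_prod _ fun i _ => hw.comp (measurable_pi_apply i))
    rw [lmarginal_insert _ hmeas hr, Finset.card_insert_of_notMem hr, Function.iterate_succ_apply',
      haarConv]
    -- rewrite the integrand as (inner function with `a' g = a g * g r`) * (the constant factor `w (g r)`)
    have hsplit : (fun g : Site 2 L → G => φ (a g * ∏ r ∈ insert r R, g r) * ∏ r ∈ insert r R, w (g r)) =
        fun g => (φ ((a g * g r) * ∏ r ∈ R, g r) * ∏ r ∈ R, w (g r)) * w (g r) := by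
      funext g; rw [Finset.prod_insert hr, Finset.prod_insert hr]; simp only [mul_assoc, mul_comm, mul_left_comm]
    have ha' : ∀ g, ∀ r' ∈ R, ∀ v, (fun g : Site 2 L → G => a g * g r) (Function.update g r' v) =
        (fun g : Site 2 L → G => a g * g r) g := by
      intro g r' hr' v
      have hne : r ≠ r' := fun h => hr (h ▸ hr')
      simp only [ha g r' (Finset.mem_insert_of_mem hr') v, Function.update_of_ne hne]
    have hF : Measurable fun g : Site 2 L → G => φ ((a g * g r) * ∏ r ∈ R, g r) * ∏ r ∈ R, w (g r) :=
      (hφ.comp ((ham.mul (measurable_pi_apply r)).mul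
        (Finset.measurable_prod _ fun i _ => measurable_pi_apply i))).mul
        (Finset.measurable_prod _ fun i _ => hw.comp (measurable_pi_apply i))
    have hc : ∀ x (y : (i : ↥R) → G), (fun g : Site 2 L → G => w (g r)) (Function.updateFinset x R y) =
        (fun g : Site 2 L → G => w (g r)) x := by
      intro x y; simp [Function.updateFinset, hr]
    have hm' : Measurable fun g : Site 2 L → G => a g * g r := ham.mul (measurable_pi_apply r)
    have hih := ih (a := fun g => a g * g r) hm' ha'
    rw [hsplit, lmarginal_mul_indep (haarProbability G) R hF hc]
    refine lintegral_congr fun v => ?_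
    show (∫⋯∫⁻_R, (fun g => φ ((a g * g r) * ∏ r ∈ R, g r) * ∏ r ∈ R, w (g r))
        ∂fun _ : Site 2 L => haarProbability G) (Function.update g r v) * w (Function.update g r v r) = _
    rw [congrFun hih (Function.update g r v)]
    simp only [Function.update_self, ha g r (Finset.mem_insert_self r R) v]

omit [CommGroup G] [TopologicalSpace G] [IsTopologicalGroup G] [CompactSpace G] [SecondCountableTopology G]
  [BorelSpace G] in
/-- A function that does not depend on the integrated coordinates is its own `lmarginal` (probability
factors). [folklore] -/
theorem lmarginal_eq_self_of_indep {ι : Type*} [DecidableEq ι] (μ : Measure G) [IsProbabilityMeasure μ]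
    (R : Finset ι) {c : (ι → G) → ℝ≥0∞} (hc : ∀ x (y : (i : ↥R) → G), c (Function.updateFinset x R y) = c x) :
    (∫⋯∫⁻_R, c ∂fun _ : ι => μ) = c := by
  funext x
  simp only [lmarginal, hc, lintegral_const, measure_univ, mul_one]

/-! ## §4. The Wilson-type weight `∏_x w(U_x)`: exact marginal formula and the sup bound -/

/-- **EXACT PLAQUETTE-MARGINAL FORMULA** (2-d, abelian).  For a measurable symmetric weight `w`, a patch `P` of
sites not containing the puncture `x₀`, and `f` measurable depending only on the `P`-coordinates:
`∫ f(U_·)·∏_x w(U_x) dHaar^{⊗E} = ∫ f(g)·∏_{x∈P} w(g_x)·(K_w^{#R} w)(∏_{x∈P} g_x) dHaar^{⊗Λ}(g)`,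
`R = (Λ ∖ x₀) ∖ P` (`#R = L² − 1 − #P`). [folklore] -/
theorem lintegral_weight_mul_eq_iterate [NeZero L] (hL : 2 ≤ L) {w : G → ℝ≥0∞} (hw : Measurable w)
    (hws : ∀ g, w g⁻¹ = w g) (x₀ : Site 2 L) (P : Finset (Site 2 L)) (hP : x₀ ∉ P)
    {f : (Site 2 L → G) → ℝ≥0∞} (hfm : Measurable f)
    (hf : ∀ g g' : Site 2 L → G, (∀ x ∈ P, g x = g' x) → f g = f g') :
    ∫⁻ U, f (fun x => plaquetteHolonomy U x 0 1) * ∏ x, w (plaquetteHolonomy U x 0 1)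
        ∂(Measure.pi fun _ : Edge 2 L => haarProbability G) =
      ∫⁻ g, f g * (∏ x ∈ P, w (g x)) *
          (haarConv w)^[((Finset.univ.erase x₀) \ P).card] w (∏ x ∈ P, g x)
        ∂(Measure.pi fun _ : Site 2 L => haarProbability G) := by
  classical
  set R : Finset (Site 2 L) := (Finset.univ.erase x₀) \ P with hRdef
  have hPR : Disjoint P R := Finset.disjoint_sdiff
  have hPsub : P ⊆ Finset.univ.erase x₀ := fun x hx =>
    Finset.mem_erase.mpr ⟨fun h => hP (h ▸ hx), Finset.mem_univ _⟩
  have hunion : Finset.univ.erase x₀ = P ∪ R := by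
    rw [hRdef, Finset.union_sdiff_of_subset hPsub]
  have hx0R : x₀ ∉ R := fun h => by simp [hRdef] at h
  -- Step 1: the integrand as a function `H = F · c` of the free holonomies
  let F : (Site 2 L → G) → ℝ≥0∞ := fun g => w ((∏ x ∈ P, g x) * ∏ r ∈ R, g r) * ∏ r ∈ R, w (g r)
  let c : (Site 2 L → G) → ℝ≥0∞ := fun g => f g * ∏ x ∈ P, w (g x)
  have hHU : ∀ U : GaugeConfig 2 L G,
      f (fun x => plaquetteHolonomy U x 0 1) * ∏ x, w (plaquetteHolonomy U x 0 1) =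
        (fun g => F g * c g) (fun x => plaquetteHolonomy U x 0 1) := by
    intro U
    simp only [F, c]
    rw [← Finset.mul_prod_erase _ _ (Finset.mem_univ x₀), plaquetteHolonomy_eq_inv_prod_erase U x₀, hws,
      hunion, Finset.prod_union hPR, Finset.prod_union hPR]
    ring
  have ham : Measurable fun g : Site 2 L → G => ∏ x ∈ P, g x :=
    Finset.measurable_prod _ fun i _ => measurable_pi_apply i
  have hFm : Measurable F :=
    (hw.comp (ham.mul (Finset.measurable_prod _ fun i _ => measurable_pi_apply i))).mul
      (Finset.measurable_prod _ fun i _ => hw.comp (measurable_pi_apply i))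
  have hcm : Measurable c := hfm.mul (Finset.measurable_prod _ fun i _ => hw.comp (measurable_pi_apply i))
  -- agreement on `P` preserves `c`; updates off `P` preserve products over `P`
  have hc_agree : ∀ g g' : Site 2 L → G, (∀ x ∈ P, g x = g' x) → c g = c g' := fun g g' hgg' => by
    simp only [c]
    rw [hf g g' hgg', Finset.prod_congr rfl fun x hx => by rw [hgg' x hx]]
  have hprodR : ∀ (g : Site 2 L → G) (v : G),
      (∏ y ∈ R, Function.update g x₀ v y) = ∏ y ∈ R, g y := fun g v =>
    Finset.prod_congr rfl fun y hy => by rw [Function.update_of_ne (ne_of_mem_of_not_mem hy hx0R)]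
  have hprodRw : ∀ (g : Site 2 L → G) (v : G),
      (∏ y ∈ R, w (Function.update g x₀ v y)) = ∏ y ∈ R, w (g y) := fun g v =>
    Finset.prod_congr rfl fun y hy => by rw [Function.update_of_ne (ne_of_mem_of_not_mem hy hx0R)]
  have hprodP : ∀ (g : Site 2 L → G) (v : G),
      (∏ y ∈ P, Function.update g x₀ v y) = ∏ y ∈ P, g y := fun g v =>
    Finset.prod_congr rfl fun y hy => by rw [Function.update_of_ne (ne_of_mem_of_not_mem hy hP)]
  have hH0 : ∀ g v, (fun g => F g * c g) (Function.update g x₀ v) = (fun g => F g * c g) g := by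
    intro g v
    have hcg : c (Function.update g x₀ v) = c g :=
      hc_agree _ _ fun x hx => Function.update_of_ne (ne_of_mem_of_not_mem hx hP) _ _
    simp only [F, hcg, hprodR, hprodRw, hprodP]
  -- Step 2: pass to the product of plaquettes
  rw [lintegral_congr hHU, lintegral_comp_plaquettes_eq_pi hL x₀ (H := fun g => F g * c g) (hFm.mul hcm) hH0]
  -- Step 3: integrate out `R`
  have hc : ∀ x (y : (i : ↥R) → G), c (Function.updateFinset x R y) = c x := fun x y =>
    hc_agree _ _ fun z hz => by
      rw [Function.updateFinset_def]
      exact dif_neg (Finset.disjoint_left.mp hPR hz)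
  have ha : ∀ g : Site 2 L → G, ∀ r ∈ R, ∀ v,
      (fun g : Site 2 L → G => ∏ x ∈ P, g x) (Function.update g r v) =
        (fun g : Site 2 L → G => ∏ x ∈ P, g x) g := fun g r hr v =>
    Finset.prod_congr rfl fun y hy => by
      rw [Function.update_of_ne (ne_of_mem_of_not_mem hr (Finset.disjoint_left.mp hPR hy)).symm]
  have hGm : Measurable fun g : Site 2 L → G => (haarConv w)^[R.card] w (∏ x ∈ P, g x) * c g :=
    ((measurable_iterate hw hw _).comp ham).mul hcm
  have hG : ∀ x (y : (i : ↥R) → G),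
      (fun g : Site 2 L → G => (haarConv w)^[R.card] w (∏ x ∈ P, g x) * c g) (Function.updateFinset x R y) =
        (fun g : Site 2 L → G => (haarConv w)^[R.card] w (∏ x ∈ P, g x) * c g) x := by
    intro x y
    have h1 : (∏ z ∈ P, Function.updateFinset x R y z) = ∏ z ∈ P, x z :=
      Finset.prod_congr rfl fun z hz => by
        rw [Function.updateFinset_def]; exact dif_neg (Finset.disjoint_left.mp hPR hz)
    simp only [h1, hc]
  have key : (∫⋯∫⁻_R, (fun g => F g * c g) ∂fun _ : Site 2 L => haarProbability G) =
      ∫⋯∫⁻_R, (fun g => (haarConv w)^[R.card] w (∏ x ∈ P, g x) * c g)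
        ∂fun _ : Site 2 L => haarProbability G := by
    rw [lmarginal_mul_indep (haarProbability G) R hFm hc,
      lmarginal_eq_self_of_indep (c := fun g => (haarConv w)^[R.card] w (∏ x ∈ P, g x) * c g) _ R hG]
    funext x
    rw [show (∫⋯∫⁻_R, F ∂fun _ : Site 2 L => haarProbability G) =
        fun g => (haarConv w)^[R.card] w ((fun g : Site 2 L → G => ∏ x ∈ P, g x) g) from
      lmarginal_weight_prod_eq_iterate hw hw R ham ha]
  rw [lintegral_eq_of_lmarginal_eq R (f := fun g => F g * c g) (hFm.mul hcm) hGm key]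
  refine lintegral_congr fun g => ?_
  simp only [c]
  ring

/-- **THE 2-D PARTITION FUNCTION AS A CONVOLUTION POWER**: `∫ ∏_x w(U_x) dHaar^{⊗E} = (K_w^{L²−1} w)(1)`.
[folklore] -/
theorem lintegral_prod_weight_eq_iterate [NeZero L] (hL : 2 ≤ L) {w : G → ℝ≥0∞} (hw : Measurable w)
    (hws : ∀ g, w g⁻¹ = w g) :
    ∫⁻ U, ∏ x, w (plaquetteHolonomy U x 0 1) ∂(Measure.pi fun _ : Edge 2 L => haarProbability G) =
      (haarConv w)^[L ^ 2 - 1] w 1 := by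
  classical
  have h := lintegral_weight_mul_eq_iterate (f := fun _ => 1) hL hw hws (0 : Site 2 L) ∅
    (Finset.notMem_empty _) measurable_const (fun _ _ _ => rfl)
  simp only [one_mul, Finset.prod_empty, Finset.sdiff_empty, Finset.card_erase_of_mem (Finset.mem_univ _),
    Finset.card_univ, lintegral_const, measure_univ, mul_one] at h
  rw [h, Fintype.card_fun, ZMod.card, Fintype.card_fin]

/-- **SUP BOUND**: `∫ f(U_·)·∏_x w(U_x) dHaar^{⊗E} ≤ M·∫ f·∏_{x∈P} w(g_x) dHaar^{⊗Λ}` whenever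
`K_w^{L²−1−#P} w ≤ M` pointwise. [folklore] -/
theorem lintegral_weight_mul_le [NeZero L] (hL : 2 ≤ L) {w : G → ℝ≥0∞} (hw : Measurable w)
    (hws : ∀ g, w g⁻¹ = w g) (x₀ : Site 2 L) (P : Finset (Site 2 L)) (hP : x₀ ∉ P)
    {f : (Site 2 L → G) → ℝ≥0∞} (hfm : Measurable f)
    (hf : ∀ g g' : Site 2 L → G, (∀ x ∈ P, g x = g' x) → f g = f g') {M : ℝ≥0∞}
    (hM : ∀ u, (haarConv w)^[((Finset.univ.erase x₀) \ P).card] w u ≤ M) :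
    ∫⁻ U, f (fun x => plaquetteHolonomy U x 0 1) * ∏ x, w (plaquetteHolonomy U x 0 1)
        ∂(Measure.pi fun _ : Edge 2 L => haarProbability G) ≤
      M * ∫⁻ g, f g * ∏ x ∈ P, w (g x) ∂(Measure.pi fun _ : Site 2 L => haarProbability G) := by
  have hmeas : AEMeasurable (fun g : Site 2 L → G => f g * ∏ x ∈ P, w (g x))
      (Measure.pi fun _ : Site 2 L => haarProbability G) :=
    (hfm.mul (Finset.measurable_prod _ fun i _ => hw.comp (measurable_pi_apply i))).aemeasurable
  rw [lintegral_weight_mul_eq_iterate hL hw hws x₀ P hP hfm hf]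
  calc _ ≤ ∫⁻ g, (f g * ∏ x ∈ P, w (g x)) * M ∂(Measure.pi fun _ : Site 2 L => haarProbability G) :=
        lintegral_mono fun g => by gcongr; exact hM _
    _ = _ := by rw [mul_comm M]; exact lintegral_mul_const'' M hmeas

end Marginal

end Summit.Ventures.LatticeQCDFlow.Theory2.Lattice.TwoDim
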